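import Literature.NumberTheory.LFunctions.HeilbronnArtinOrder
import Literature.NumberTheory.Automorphic.ArtinLFunctionsBrauerDualProofs
import Literature.NumberTheory.Automorphic.ArtinLFunctionsAbelianHeckeProofs
import Literature.NumberTheory.GaloisRepresentations.ArtinLFunctionOrderAtOneProofs
import Literature.NumberTheory.LFunctions.DedekindZetaEntireConvexity
import HarnessLib

/-!
# Heilbronn's formalism, II: `⟨φ, θ_G⟩ = n(G, φ)`, induction, and the Dedekind zeta functions of the fixed fields

Topic `Literature/NumberTheory/LFunctions`, grouping namespace
`Literature.NumberTheory.LFunctions.Heilbronn` (sequel to `HeilbronnArtinOrder.lean`).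
Everything in this file is PROVED (theorems only).

For a number field `F`, a finite group `G` exhibited as a Galois group over `F` by
`q : Γ_F → G` (`Automorphic.IsArtinQuotient q`) and a point `s₀`, the integers
`n(G, φ) := Heilbronn.artinOrder s₀ (φ ∘ q)` attached to characters `φ` of `G` and Heilbronn's
character `θ_G = Σ_χ n(G, χ) χ` (`Heilbronn.heilbronnChar`) satisfy
([MurtyMurty1997, Ch. 2 §5, properties (1)–(2) and Prop. 5.1]):

* `artinOrder_comp_add`, `artinOrder_comp_multiset_sum` — additivity on characters of `G`;
* `classInner_heilbronnChar` — **`⟨φ, θ_G⟩ = n(G, φ)`** for every character `φ` of `G`;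
* `classInner_restrict_heilbronnChar` — Frobenius reciprocity form
  `⟨θ, θ_G|_H⟩_H = n(G, Ind_H^G θ)` for characters `θ` of degree one of `H ≤ G`;
* `artinOrder_indClassFun_eq` — **induction invariance**: `n(G, Ind_H^G θ)` is the order at `s₀`
  of (any meromorphic continuation of) the `L`-function of the character `ψ` of degree one of
  `Γ_{F_H}` cut out by `(H, θ)` (`IsArtinQuotient.cutCharacter`; Neukirch VII (10.4) (iv),
  PROVED in the tree as `artinLFunction_eq_of_isInducedFrom_holds`);
* `artinOrder_indClassFun_nonneg_of_ne_one` — `n(G, Ind_H^G θ) ≥ 0` for `θ ≠ 1` (Artin's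
  conjecture in degree one, PROVED in the tree: `artinLFunction_hasEntireContinuation_of_rank_one_holds`);
* `artinLFunction_cutCharacter_one`, `artinOrder_indClassFun_one`,
  `artinOrder_indClassFun_one_pos_iff` — for `θ = 1` the `L`-function is `ζ_{F_H}` of the fixed
  field `F_H = F̄^{q⁻¹(H)}` (`quotientFixedField q H`), so `n(G, Ind_H^G 1) = ord_{s₀} ζ_{F_H}`,
  which off `s₀ = 1` is `≥ 0` and positive iff `ζ_{F_H}(s₀) = 0`.

## References

* M. R. Murty, V. K. Murty, *Non-vanishing of `L`-functions and applications*, Birkhäuser 1997,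
  Ch. 2 §5. [MurtyMurty1997]
* J. Neukirch, *Algebraic Number Theory*, Springer 1999, VII (10.4), (10.6). [NeukirchANT1999]
-/

noncomputable section

open Filter Complex Set
open scoped Topology

namespace Literature.NumberTheory.LFunctions

namespace Heilbronn

open Literature.NumberTheory.GaloisRepresentations Literature.NumberTheory.Automorphic

universe u


section CharacterProps

open Literature.RepresentationTheory.FiniteGroups

variable {F : Type} [Field F] [NumberField F] {G : Type} [Group G] [Fintype G]
  {q : Field.absoluteGaloisGroup F →* G}

/-! ### Additivity over characters of `G` -/

omit [NumberField F] [Fintype G] in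
/-- `(φ + ψ) ∘ q = φ ∘ q + ψ ∘ q`. [folklore] -/
theorem add_comp_eq (φ ψ : G → ℂ) :
    ((φ + ψ) ∘ q : Field.absoluteGaloisGroup F → ℂ) = φ ∘ q + ψ ∘ q := rfl

/-- Additivity of `artinOrder` on characters of `G`. [cite: MurtyMurty1997, Ch. 2 §5] -/
theorem artinOrder_comp_add (hq : IsArtinQuotient q) (s₀ : ℂ) {φ ψ : G → ℂ}
    (hφ : IsCharacter G φ) (hψ : IsCharacter G ψ) :
    artinOrder s₀ ((φ + ψ) ∘ q) = artinOrder s₀ (φ ∘ q) + artinOrder s₀ (ψ ∘ q) := by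
  obtain ⟨L, hL⟩ := exists_hasArtinRealization_comp hq hφ
  obtain ⟨L', hL'⟩ := exists_hasArtinRealization_comp hq hψ
  rw [add_comp_eq]
  exact artinOrder_add hL hL'

/-- A multiset sum of characters of `G`, pulled back along `q`, is realised. [folklore] -/
theorem exists_hasArtinRealization_multiset_sum (hq : IsArtinQuotient q) {m : Multiset (G → ℂ)}
    (hm : ∀ χ ∈ m, IsCharacter G χ) :
    ∃ L : ℂ → ℂ, HasArtinRealization (m.sum ∘ q : Field.absoluteGaloisGroup F → ℂ) L := by
  induction m using Multiset.induction_on with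
  | empty => exact ⟨1, by simpa using (HasArtinRealization.one (K := F))⟩
  | cons χ m ih =>
    obtain ⟨L, hL⟩ := exists_hasArtinRealization_comp hq (hm χ (Multiset.mem_cons_self _ _))
    obtain ⟨L', hL'⟩ := ih fun χ' hχ' => hm χ' (Multiset.mem_cons_of_mem hχ')
    refine ⟨L * L', ?_⟩
    rw [Multiset.sum_cons, add_comp_eq]
    exact hL.mul hL'

/-- Additivity of `artinOrder` over a multiset of characters. [cite: MurtyMurty1997, Ch. 2 §5] -/
theorem artinOrder_comp_multiset_sum (hq : IsArtinQuotient q) (s₀ : ℂ) {m : Multiset (G → ℂ)}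
    (hm : ∀ χ ∈ m, IsCharacter G χ) :
    artinOrder s₀ (m.sum ∘ q) = (m.map fun χ => artinOrder s₀ (χ ∘ q)).sum := by
  induction m using Multiset.induction_on with
  | empty => simpa using artinOrder_zero (K := F) s₀
  | cons χ m ih =>
    obtain ⟨L, hL⟩ := exists_hasArtinRealization_comp hq (hm χ (Multiset.mem_cons_self _ _))
    obtain ⟨L', hL'⟩ := exists_hasArtinRealization_multiset_sum hq
      (fun χ' hχ' => hm χ' (Multiset.mem_cons_of_mem hχ'))
    rw [Multiset.sum_cons, Multiset.map_cons, Multiset.sum_cons, add_comp_eq, artinOrder_add hL hL',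
      ih fun χ' hχ' => hm χ' (Multiset.mem_cons_of_mem hχ')]

/-! ### `⟨φ, θ_G⟩ = n(φ)` for every character `φ` -/

/-- For an irreducible `χ`: `⟨χ, θ_G⟩ = artinOrder s₀ (χ ∘ q)` (orthonormality).
[cite: MurtyMurty1997, Ch. 2 §5] -/
theorem classInner_heilbronnChar_of_isIrrChar (s₀ : ℂ) {χ : G → ℂ} (hχ : IsIrrChar G χ) :
    classInner χ (heilbronnChar q s₀) = artinOrder s₀ (χ ∘ q) := by
  classical
  rw [classInner_comm, heilbronnChar, classInner_sum_left]
  have hmem : χ ∈ (irrChars_finite_holds G).toFinset := (irrChars_finite_holds G).mem_toFinset.mpr hχ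
  have : ∀ χ' ∈ (irrChars_finite_holds G).toFinset,
      classInner ((artinOrder s₀ (χ' ∘ q) : ℂ) • χ') χ =
        if χ' = χ then (artinOrder s₀ (χ ∘ q) : ℂ) else 0 := by
    intro χ' hχ'
    rw [classInner_smul_left,
      IsIrrChar.classInner_eq ((irrChars_finite_holds G).mem_toFinset.mp hχ') hχ]
    by_cases h : χ' = χ
    · subst h; simp
    · simp [h]
  rw [Finset.sum_congr rfl this, Finset.sum_ite_eq' _ χ, if_pos hmem]

/-- **`⟨φ, θ_G⟩ = n(G, φ)` for every character `φ` of `G`** (the defining property of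
Heilbronn's character, [MurtyMurty1997, Ch. 2 §5, proof of Prop. 5.1]: by additivity (1),
`Σ_χ n(G, χ)(χ, φ) = n(G, φ)`). [cite: MurtyMurty1997, Ch. 2 §5] -/
theorem classInner_heilbronnChar (hq : IsArtinQuotient q) (s₀ : ℂ) {φ : G → ℂ}
    (hφ : IsCharacter G φ) :
    classInner φ (heilbronnChar q s₀) = artinOrder s₀ (φ ∘ q) := by
  obtain ⟨m, hm, rfl⟩ := hφ.exists_multiset_irrChars
  rw [artinOrder_comp_multiset_sum hq s₀ fun χ hχ => (hm χ hχ).isCharacter,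
    classInner_multiset_sum_left]
  push_cast
  rw [Multiset.map_map]
  congr 1
  refine Multiset.map_congr rfl fun χ hχ => ?_
  exact classInner_heilbronnChar_of_isIrrChar s₀ (hm χ hχ)

/-- **Frobenius reciprocity form**: for `H ≤ G` and a character `θ` of degree one of `H`,
`⟨θ, θ_G|_H⟩_H = n(G, Ind_H^G θ) = artinOrder s₀ ((Ind_H^G θ) ∘ q)`.
[cite: MurtyMurty1997, Ch. 2 §5 Prop. 5.1] -/
theorem classInner_restrict_heilbronnChar (hq : IsArtinQuotient q) (s₀ : ℂ) (H : Subgroup G)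
    [Fintype H] (θ : H →* ℂˣ) :
    classInner (fun h : H => (θ h : ℂ)) (fun h : H => heilbronnChar q s₀ h) =
      artinOrder s₀ (indClassFun H (fun h => (θ h : ℂ)) ∘ q) := by
  rw [← classInner_indClassFun_left H _ (isClassFun_heilbronnChar q s₀)]
  exact classInner_heilbronnChar hq s₀ (isCharacter_indClassFun_monoidHom H θ)

/-! ### Induced characters of degree one: the cut-out character -/

/-- The monomial Artin representation realises `(Ind_H^G θ) ∘ q` with its own `L`-function.
[cite: NeukirchANT1999, VII proof of (12.6)] -/
theorem hasArtinRealization_indClassFun (hq : IsArtinQuotient q) (H : Subgroup G) (θ : H →* ℂˣ) :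
    HasArtinRealization (indClassFun H (fun h => (θ h : ℂ)) ∘ q)
      (artinLFunction (ArtinRep.monomial hq H θ)) :=
  ⟨G ⧸ H → ℂ, _, _, inferInstance, _, inferInstance, ArtinRep.monomial hq H θ,
    fun γ => ArtinRep.character_monomial hq H θ γ, fun _ _ => rfl⟩

/-- **`n(G, Ind_H^G θ)` is the order at `s₀` of the `L`-function of the cut-out character**
`ψ = θ ∘ (Γ_{F_H} → H)` of `Γ_{F_H}`, `F_H = F̄^{q⁻¹(H)}` — induction invariance of Artin
`L`-functions (Neukirch VII (10.4) (iv), PROVED in the tree) and `Ind_H^G θ ∘ q ≅ Ind ψ`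
(`ArtinRep.isInducedFrom_monomial`): for any meromorphic `g` continuing `L(s, ψ)`.
[cite: MurtyMurty1997, Ch. 2 §5, property (2)] [cite: NeukirchANT1999, VII (10.4) (iv)] -/
theorem artinOrder_indClassFun_eq (hq : IsArtinQuotient q) (s₀ : ℂ) (H : Subgroup G) (θ : H →* ℂˣ)
    [NumberField (quotientFixedField q H)] {g : ℂ → ℂ} (hg : Meromorphic g)
    (hgL : ∀ s : ℂ, 1 < s.re → g s = artinLFunction (hq.cutCharacter H θ).toArtinRep s) :
    (artinOrder s₀ (indClassFun H (fun h => (θ h : ℂ)) ∘ q) : WithTop ℤ) = meromorphicOrderAt g s₀ := by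
  refine artinOrder_eq_meromorphicOrderAt (hasArtinRealization_indClassFun hq H θ) hg fun s hs => ?_
  rw [hgL s hs]
  exact (artinLFunction_eq_of_isInducedFrom_holds (K := F) (M := quotientFixedField q H)
    (V := G ⧸ H → ℂ) (W := Fin 1 → ℂ) (ArtinRep.monomial hq H θ) (hq.cutCharacter H θ).toArtinRep
    (ArtinRep.isInducedFrom_monomial hq H θ) s hs).symm

omit [Fintype G] in
/-- For `θ ≠ 1` the cut-out character is non-trivial. [folklore] -/
theorem exists_cutCharacter_ne_one (hq : IsArtinQuotient q) (H : Subgroup G) {θ : H →* ℂˣ}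
    (hθ : θ ≠ 1) : ∃ δ, hq.cutCharacter H θ δ ≠ 1 := by
  obtain ⟨h, hh⟩ : ∃ h, θ h ≠ 1 := by
    by_contra hall
    push Not at hall
    exact hθ (MonoidHom.ext hall)
  obtain ⟨δ, hδ⟩ := hq.cutHomAux_surjective H h
  refine ⟨δ, fun h1 => hh ?_⟩
  have : hq.cutHom H θ δ = 1 := by
    have h1' := congrArg (fun M : GL (Fin 1) ℂ => (M : Matrix (Fin 1) (Fin 1) ℂ) 0 0) h1
    simpa [hq.cutCharacter_apply_coe] using h1'
  rwa [hq.cutHom_apply, hδ] at this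

/-- **`n(G, Ind_H^G θ) ≥ 0` for `θ ≠ 1`**: the `L`-function of a non-trivial character of degree one
is entire (Artin's conjecture in degree one = Artin reciprocity + Hecke, PROVED in the tree:
`artinLFunction_hasEntireContinuation_of_rank_one_holds`).
[cite: MurtyMurty1997, Ch. 2 §5 (hypothesis of Prop. 5.2)] [cite: NeukirchANT1999, VII (10.6) and (8.5)] -/
theorem artinOrder_indClassFun_nonneg_of_ne_one (hq : IsArtinQuotient q) (s₀ : ℂ) (H : Subgroup G)
    {θ : H →* ℂˣ} (hθ : θ ≠ 1) [NumberField (quotientFixedField q H)] :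
    0 ≤ artinOrder s₀ (indClassFun H (fun h => (θ h : ℂ)) ∘ q) := by
  have hent := artinLFunction_hasEntireContinuation_of_rank_one_holds (hq.cutCharacter H θ)
    (exists_cutCharacter_ne_one hq H hθ)
  obtain ⟨g, hg, hgL⟩ := hent
  have heq := artinOrder_indClassFun_eq hq s₀ H θ (fun x => (hg.analyticAt x).meromorphicAt) hgL
  have hnn := (hg.analyticAt s₀).meromorphicOrderAt_nonneg
  rw [← heq] at hnn
  exact_mod_cast hnn

/-! ### The trivial character: Dedekind zeta functions of the fixed fields -/

/-- `ζ_M` is meromorphic on `ℂ` (holomorphic off `1`; at `1`, `ζ_M = (s − 1)⁻¹ ζ₁_M` with `ζ₁_M`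
entire). [folklore] -/
theorem meromorphic_dedekindZetaCont (M : Type*) [Field M] [NumberField M] :
    Meromorphic (dedekindZetaCont M) := by
  intro x
  by_cases hx : x = 1
  · subst hx
    have h1 : MeromorphicAt (dedekindZeta₁ M) 1 :=
      ((dedekindZeta₁_differentiable M).analyticAt 1).meromorphicAt
    have hinv : MeromorphicAt (fun z : ℂ => (z - 1)⁻¹) 1 :=
      ((MeromorphicAt.id 1).sub (MeromorphicAt.const 1 1)).inv
    refine (hinv.mul h1).congr ?_
    filter_upwards [self_mem_nhdsWithin] with z hz
    rw [Pi.mul_apply, dedekindZeta₁_apply_of_ne_one hz, ← mul_assoc, inv_mul_cancel₀ (sub_ne_zero.mpr hz),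
      one_mul]
  · exact ((differentiableOn_dedekindZetaCont_holds M).analyticAt
      (isOpen_compl_singleton.mem_nhds hx)).meromorphicAt

omit [Fintype G] in
/-- The cut-out character for `θ = 1` has the trivial character. [folklore] -/
theorem character_cutCharacter_one (hq : IsArtinQuotient q) (H : Subgroup G)
    (δ : Field.absoluteGaloisGroup (quotientFixedField q H)) :
    (hq.cutCharacter H 1).toArtinRep.toRepresentation.character δ = 1 := by
  rw [FramedArtinRep.toArtinRep, FramedRep.character_toContinuousRep_eq_trace, FramedRep.trace,
    Matrix.trace_fin_one, hq.cutCharacter_apply_coe, hq.cutHom_apply, MonoidHom.one_apply, Units.val_one]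

omit [Fintype G] in
/-- **The `L`-function of the trivial cut-out character is `ζ_{F_H}`** on `re s > 1`
(`artinLFunction_trivial_eq_dedekindZeta_holds`, character invariance).
[cite: NeukirchANT1999, VII (10.4) (iii) and §5] -/
theorem artinLFunction_cutCharacter_one (hq : IsArtinQuotient q) (H : Subgroup G)
    [NumberField (quotientFixedField q H)] {s : ℂ} (hs : 1 < s.re) :
    artinLFunction (hq.cutCharacter H 1).toArtinRep s = dedekindZetaCont (quotientFixedField q H) s := by
  have hchar := artinLFunction_eq_of_character_eq_holds (hq.cutCharacter H 1).toArtinRep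
    (ContinuousRep.trivial (Field.absoluteGaloisGroup (quotientFixedField q H)) ℂ ℂ) (fun δ => by
      rw [character_cutCharacter_one]
      simp [Representation.character, ContinuousRep.trivial])
  rw [hchar, artinLFunction_trivial_eq_dedekindZeta_holds (quotientFixedField q H) hs,
    dedekindZetaCont_eq_dedekindZeta_holds hs]

/-- `Ind_H^G 1` with `1 : H →* ℂˣ` coerced is `Ind_H^G (fun _ ↦ 1)`. [folklore] -/
theorem indClassFun_one_coe (H : Subgroup G) :
    indClassFun H (fun h : H => ((1 : H →* ℂˣ) h : ℂ)) = indClassFun H (fun _ => (1 : ℂ)) := by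
  simp only [MonoidHom.one_apply, Units.val_one]

/-- **`n(G, Ind_H^G 1)` is the order of `ζ_{F_H}` at `s₀`** (`F_H = F̄^{q⁻¹(H)}`).
[cite: MurtyMurty1997, Ch. 2 §5–§6 ("the factorization of `ζ_K` into the `L(s,χ,F)`")] -/
theorem artinOrder_indClassFun_one (hq : IsArtinQuotient q) (s₀ : ℂ) (H : Subgroup G)
    [NumberField (quotientFixedField q H)] :
    (artinOrder s₀ (indClassFun H (fun _ => (1 : ℂ)) ∘ q) : WithTop ℤ) =
      meromorphicOrderAt (dedekindZetaCont (quotientFixedField q H)) s₀ := by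
  rw [← indClassFun_one_coe]
  exact artinOrder_indClassFun_eq hq s₀ H 1 (meromorphic_dedekindZetaCont _)
    fun s hs => (artinLFunction_cutCharacter_one hq H hs).symm

/-- Off `s₀ = 1`: `n(G, Ind_H^G 1) ≥ 0`, and `> 0` iff `ζ_{F_H}(s₀) = 0`. [folklore] -/
theorem artinOrder_indClassFun_one_pos_iff (hq : IsArtinQuotient q) {s₀ : ℂ} (hs₀ : s₀ ≠ 1)
    (H : Subgroup G) [NumberField (quotientFixedField q H)] :
    0 ≤ artinOrder s₀ (indClassFun H (fun _ => (1 : ℂ)) ∘ q) ∧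
      (0 < artinOrder s₀ (indClassFun H (fun _ => (1 : ℂ)) ∘ q) ↔
        dedekindZetaCont (quotientFixedField q H) s₀ = 0) := by
  have han : AnalyticAt ℂ (dedekindZetaCont (quotientFixedField q H)) s₀ :=
    (differentiableOn_dedekindZetaCont_holds _).analyticAt (isOpen_compl_singleton.mem_nhds hs₀)
  have hR : HasArtinRealization (indClassFun H (fun _ => (1 : ℂ)) ∘ q)
      (artinLFunction (ArtinRep.monomial hq H 1)) := by
    rw [← indClassFun_one_coe]; exact hasArtinRealization_indClassFun hq H 1
  have hgL : ∀ s : ℂ, 1 < s.re →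
      dedekindZetaCont (quotientFixedField q H) s = artinLFunction (ArtinRep.monomial hq H 1) s := by
    intro s hs
    rw [← artinLFunction_cutCharacter_one hq H hs]
    exact (artinLFunction_eq_of_isInducedFrom_holds (K := F) (M := quotientFixedField q H)
      (V := G ⧸ H → ℂ) (W := Fin 1 → ℂ) (ArtinRep.monomial hq H 1) (hq.cutCharacter H 1).toArtinRep
      (ArtinRep.isInducedFrom_monomial hq H 1) s hs).symm
  refine ⟨?_, artinOrder_pos_iff hR (meromorphic_dedekindZetaCont _) hgL han⟩
  have heq := artinOrder_eq_meromorphicOrderAt (s₀ := s₀) hR (meromorphic_dedekindZetaCont _) hgL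
  have hnn := han.meromorphicOrderAt_nonneg
  rw [← heq] at hnn
  exact_mod_cast hnn

end CharacterProps


end Heilbronn

end Literature.NumberTheory.LFunctions

end
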